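import Literature.NumberTheory.Weil1964.ArchActQuadraticPlaces
import Literature.NumberTheory.Weil1964.AdelicMetaplecticOfArchImplementer
import Mathlib.RingTheory.Norm.Transitivity
import Mathlib.RingTheory.Complex
import Mathlib.Topology.Instances.RealVectorSpace
import HarnessLib

/-!
# Restriction of scalars `E/F` on archimedean pairs, read in the mixed space of `E` (uniform in the place type)

Topic `NumberTheory/Weil1964`; namespace `Literature.NumberTheory.Weil1964`.  KERNEL only: definitions with bodies and
proved theorems; no named fact, no `sorry`.

**Setting.** `E/F` a quadratic extension of number fields, `c ∈ Aut(E/F)`, `δ ∈ E` with `c δ = -δ ≠ 0`, the adelic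
quadratic coordinates `Ψ_𝔸 : 𝔸_F × 𝔸_F ≃ 𝔸_E`, `(a, b) ↦ a ⊗ 1 + (b ⊗ 1) δ` (`quadraticAdeleEquiv`), the archimedean
coordinates `archVec : (F ⊗ ℝ)^k → 𝔸_F^k`, `piArch : 𝔸_K^k → (K ⊗ ℝ)^k` of the Weil1964 files (`K ⊗ ℝ` = Mathlib's
`mixedSpace K`), and `archMat K G = G_∞` (the archimedean part of an adelic matrix).

* §1 `adeleVecE (a, b) = (Ψ_𝔸 (a_j, b_j))_j ∈ 𝔸_E^k` — the `E`-adelic vector of an archimedean pair `(a, b)`; its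
  finite part vanishes; `(archVec a, archVec b) = reIm Ψ_𝔸 (adeleVecE (a, b))`.
* §2 **`archPairMixed : ((F ⊗ ℝ)^k × (F ⊗ ℝ)^k) ≃L[ℝ] (E ⊗ ℝ)^k`**, `(a, b) ↦ ((Ψ_𝔸 (a_j, b_j))_∞)_j` — the
  identification `(F ⊗ ℝ) ⊕ (F ⊗ ℝ) δ = E ⊗ ℝ` ("quadratic coordinates at `∞`"), vector-wise; a homeomorphic additive
  bijection (explicit inverse through `Ψ_𝔸⁻¹` on archimedean adeles), hence real-linear (`AddEquiv.toRealLinearEquiv`).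
  UNIFORM in the type of the archimedean places of `F` (real or complex) and of `E`.
* §3 for `G ∈ M_k(𝔸_E)` the archimedean restriction-of-scalars action
  `archResFun G (a, b) = (piArch (reIm Ψ_𝔸 (G · adeleVecE (a, b))).1, piArch (…).2)` (for `g ∈ U(J)(𝔸_F)` and `G = g` this
  is the tree's `archAct (ι_𝔸 g) (a, b)`, `adelicToSymplectic_reIm`) is carried by `archPairMixed` to `y ↦ G_∞ y` on
  `(E ⊗ ℝ)^k` (`archPairMixed_archResFun`); **`archResLin G`** = that action as a real-linear endomorphism of the pairs,
  `archResLin_apply : archResLin G = archResFun G`, and **`det_archResLin : det_ℝ (archResLin G) = N_{(E⊗ℝ)/ℝ}(det G_∞)`**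
  (Mathlib `LinearMap.det_restrictScalars`).
* §4 `E` TOTALLY COMPLEX: `N_{(E⊗ℝ)/ℝ}(x) = ∏_{w} |x_w|²` over the (complex) places `w` of `E`
  (`norm_mixedSpace_of_isTotallyComplex`), whence
  **`det_archResLin_of_isTotallyComplex : det_ℝ (archResLin G) = ∏_w |det σ_w(G_w)|²`** (`adeleMatAt`), in particular
  `0 < det_ℝ` as soon as every `det G_w ≠ 0`.

This is the place-free form of `ArchActQuadraticPlaces.placeVec_piArch_resEnd` (there: a REAL place `v` of `F` under a
complex place `w`; here: all archimedean places at once, so complex places of `F` — two places of `E` above — need no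
separate dictionary).  Consumer: the archimedean MODULUS input `hdiag` of the general-`E/F` doubling construction of
[GelbartRogawski1991, Prop. 3.1.1] (`GelbartRogawski1991/DoubledUnitaryArchSiegelDiagonalModulusGen`).

Dictionary with print: `E ⊗_F 𝔸_F = 𝔸_E` and `E ⊗_ℚ ℝ = ∏_{w ∣ ∞} E_w` [CasselsFrohlichANT1967, Ch. II §14]; the
embedding `ι : U(V)(𝔸) → Sp(Res_{E/F} V)(𝔸)` is restriction of scalars [GelbartRogawski1991, §3.1 p. 454]; on the Siegel
Levi `m(a)` acts through `a` and `|x(m(a))| = |det a|` [Kudla1994, §3], whose archimedean factor is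
`|N_{(E⊗ℝ)/ℝ}(det a_∞)| = ∏_w |det a_w|_ℂ²`.

## References
* [CasselsFrohlichANT1967] J. W. S. Cassels, A. Fröhlich (eds.), *Algebraic Number Theory* (1967), Ch. II §14.
* [GelbartRogawski1991] S. Gelbart, J. Rogawski, Invent. Math. 105 (1991), §3.1 p. 454.
* [Kudla1994] S. S. Kudla, Israel J. Math. 87 (1994), §3.
-/

set_option autoImplicit false

noncomputable section

open scoped Matrix Classical
open NumberField NumberField.InfinitePlace NumberField.mixedEmbedding IsDedekindDomain

namespace Literature.NumberTheory.Weil1964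

open Literature.NumberTheory.Automorphic Literature.NumberTheory.Automorphic.UnitaryGroup QuadraticCoordinates

variable (F : Type) [Field F] [NumberField F] (E : Type) [Field E] [NumberField E] [Algebra F E]
  [Algebra.IsQuadraticExtension F E] (c : E ≃ₐ[F] E) {δ : E} (hcδ : c δ = -δ) (hδ : δ ≠ 0)
  (k : Type)

/-! ## §1 The `E`-adelic vector of an archimedean pair -/

/-- **`adeleVecE (a, b) = (Ψ_𝔸 (a_j, b_j))_j ∈ 𝔸_E^k`**: the `E`-adelic vector whose quadratic coordinates are the
archimedean adelic vectors `archVec a`, `archVec b` (`= (reIm Ψ_𝔸)⁻¹ (archVec a, archVec b)`).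
[cite: CasselsFrohlichANT1967, Ch. II §14] -/
def adeleVecE (ab : (k → mixedSpace F) × (k → mixedSpace F)) : k → AdeleRing (𝓞 E) E :=
  (reIm (quadraticAdeleEquiv F E c hcδ hδ).toAddEquiv k).symm (archVec F k ab.1, archVec F k ab.2)

/-- components: `adeleVecE (a, b) j = Ψ_𝔸 (archVec a j, archVec b j)`. [cite: CasselsFrohlichANT1967, Ch. II §14] -/
theorem adeleVecE_apply (ab : (k → mixedSpace F) × (k → mixedSpace F)) (j : k) :
    adeleVecE F E c hcδ hδ k ab j = quadraticAdeleEquiv F E c hcδ hδ (archVec F k ab.1 j, archVec F k ab.2 j) := rfl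

/-- `reIm Ψ_𝔸 (adeleVecE (a, b)) = (archVec a, archVec b)`. [cite: CasselsFrohlichANT1967, Ch. II §14] -/
theorem reIm_adeleVecE (ab : (k → mixedSpace F) × (k → mixedSpace F)) :
    reIm (quadraticAdeleEquiv F E c hcδ hδ).toAddEquiv k (adeleVecE F E c hcδ hδ k ab) =
      (archVec F k ab.1, archVec F k ab.2) :=
  (reIm (quadraticAdeleEquiv F E c hcδ hδ).toAddEquiv k).apply_symm_apply _

omit [NumberField F] [Algebra.IsQuadraticExtension F E] in
/-- the finite part of `Ψ_𝔸 (p, q)` vanishes when those of `p`, `q` do. [cite: CasselsFrohlichANT1967, Ch. II §14] -/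
theorem quadraticAdeleEquiv_snd_eq_zero [NumberField F] [Algebra.IsQuadraticExtension F E]
    (p q : AdeleRing (𝓞 F) F) (hp : p.2 = 0) (hq : q.2 = 0) :
    (quadraticAdeleEquiv F E c hcδ hδ (p, q)).2 = 0 := by
  change (quadraticAdeleMap F E δ (p, q)).2 = 0
  rw [quadraticAdeleMap_snd]
  change quadraticFiniteAdeleMap F E δ (p.2, q.2) = 0
  rw [hp, hq, ← Prod.zero_eq_mk, map_zero]

omit [NumberField F] [Algebra.IsQuadraticExtension F E] in
/-- the archimedean part of `Ψ_𝔸 (p, q)` depends only on those of `p`, `q`. [cite: CasselsFrohlichANT1967, Ch. II §14] -/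
theorem quadraticAdeleEquiv_fst_congr [NumberField F] [Algebra.IsQuadraticExtension F E]
    {p q p' q' : AdeleRing (𝓞 F) F} (hp : p.1 = p'.1) (hq : q.1 = q'.1) :
    (quadraticAdeleEquiv F E c hcδ hδ (p, q)).1 = (quadraticAdeleEquiv F E c hcδ hδ (p', q')).1 := by
  change (quadraticAdeleMap F E δ (p, q)).1 = (quadraticAdeleMap F E δ (p', q')).1
  rw [quadraticAdeleMap_fst, quadraticAdeleMap_fst]
  change quadraticInfiniteAdeleMap F E δ (p.1, q.1) = quadraticInfiniteAdeleMap F E δ (p'.1, q'.1)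
  rw [hp, hq]

/-- the finite part of `adeleVecE (a, b)` vanishes. [cite: CasselsFrohlichANT1967, Ch. II §14] -/
theorem adeleVecE_apply_snd (ab : (k → mixedSpace F) × (k → mixedSpace F)) (j : k) :
    (adeleVecE F E c hcδ hδ k ab j).2 = 0 :=
  quadraticAdeleEquiv_snd_eq_zero F E c hcδ hδ _ _ (archVec_apply_snd ab.1 j) (archVec_apply_snd ab.2 j)

/-- `adeleVecE` is additive. [cite: CasselsFrohlichANT1967, Ch. II §14] -/
theorem adeleVecE_add (ab ab' : (k → mixedSpace F) × (k → mixedSpace F)) :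
    adeleVecE F E c hcδ hδ k (ab + ab') = adeleVecE F E c hcδ hδ k ab + adeleVecE F E c hcδ hδ k ab' := by
  funext j
  rw [Pi.add_apply, adeleVecE_apply, adeleVecE_apply, adeleVecE_apply, ← map_add, Prod.mk_add_mk]
  congr 1
  refine Prod.ext ?_ ?_ <;> simp only [Prod.fst_add, Prod.snd_add, archVec_add, Pi.add_apply]

/-! ## §2 `((F ⊗ ℝ)^k × (F ⊗ ℝ)^k) ≃L[ℝ] (E ⊗ ℝ)^k` -/

/-- the forward map `(a, b) ↦ ((Ψ_𝔸 (a_j, b_j))_∞)_j`. [cite: CasselsFrohlichANT1967, Ch. II §14] -/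
def archPairMixedFun (ab : (k → mixedSpace F) × (k → mixedSpace F)) : k → mixedSpace E :=
  piArch E k (adeleVecE F E c hcδ hδ k ab)

/-- the archimedean adele `(y_∞, 0) ∈ 𝔸_E` of `y ∈ E ⊗ ℝ`, split by `Ψ_𝔸⁻¹` into a pair of `F`-adeles.
[cite: CasselsFrohlichANT1967, Ch. II §14] -/
def splitArch (y : mixedSpace E) : AdeleRing (𝓞 F) F × AdeleRing (𝓞 F) F :=
  (quadraticAdeleEquiv F E c hcδ hδ).symm
    (infiniteAdeleInl E ((InfiniteAdeleRing.ringEquiv_mixedSpace E).symm y))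

/-- the inverse map `y ↦ (((Ψ_𝔸⁻¹ (y_j, 0)).1)_∞, ((Ψ_𝔸⁻¹ (y_j, 0)).2)_∞)_j`. [cite: CasselsFrohlichANT1967, Ch. II §14] -/
def archPairMixedInv (y : k → mixedSpace E) : (k → mixedSpace F) × (k → mixedSpace F) :=
  (piArch F k fun j => (splitArch F E c hcδ hδ (y j)).1, piArch F k fun j => (splitArch F E c hcδ hδ (y j)).2)

/-- the finite parts of `Ψ_𝔸⁻¹ (y_∞, 0)` vanish. [cite: CasselsFrohlichANT1967, Ch. II §14] -/
theorem splitArch_snd (y : mixedSpace E) :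
    (splitArch F E c hcδ hδ y).1.2 = 0 ∧ (splitArch F E c hcδ hδ y).2.2 = 0 := by
  have h := quadraticAdeleEquiv_symm_snd E c hcδ hδ
    (infiniteAdeleInl E ((InfiniteAdeleRing.ringEquiv_mixedSpace E).symm y))
  have h0 : (infiniteAdeleInl E ((InfiniteAdeleRing.ringEquiv_mixedSpace E).symm y)).2 = 0 := rfl
  rw [h0, map_zero, Prod.ext_iff] at h
  exact h

/-- `Ψ_𝔸 (splitArch y) = (y_∞, 0)`. [cite: CasselsFrohlichANT1967, Ch. II §14] -/
theorem quadraticAdeleEquiv_splitArch (y : mixedSpace E) :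
    quadraticAdeleEquiv F E c hcδ hδ (splitArch F E c hcδ hδ y) =
      infiniteAdeleInl E ((InfiniteAdeleRing.ringEquiv_mixedSpace E).symm y) :=
  (quadraticAdeleEquiv F E c hcδ hδ).apply_symm_apply _

/-- an adelic vector with vanishing finite parts is `archVec` of its archimedean part.
[cite: CasselsFrohlichANT1967, Ch. II §14] -/
theorem archVec_piArch_of_snd_eq_zero (K : Type) [Field K] [NumberField K] (X : k → AdeleRing (𝓞 K) K)
    (hX : ∀ j, (X j).2 = 0) : archVec K k (piArch K k X) = X := by
  funext j
  refine Prod.ext ?_ ?_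
  · rw [archVec_apply_fst, piArch_apply, RingEquiv.symm_apply_apply]
  · rw [archVec_apply_snd, hX j]

/-- left inverse. [cite: CasselsFrohlichANT1967, Ch. II §14] -/
theorem archPairMixedInv_archPairMixedFun (ab : (k → mixedSpace F) × (k → mixedSpace F)) :
    archPairMixedInv F E c hcδ hδ k (archPairMixedFun F E c hcδ hδ k ab) = ab := by
  have key : ∀ j, splitArch F E c hcδ hδ (archPairMixedFun F E c hcδ hδ k ab j) =
      (archVec F k ab.1 j, archVec F k ab.2 j) := by
    intro j
    unfold splitArch
    rw [ContinuousAddEquiv.symm_apply_eq]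
    refine Prod.ext ?_ ?_
    · change (InfiniteAdeleRing.ringEquiv_mixedSpace E).symm
          (InfiniteAdeleRing.ringEquiv_mixedSpace E (adeleVecE F E c hcδ hδ k ab j).1) = _
      rw [RingEquiv.symm_apply_apply]
      rfl
    · exact (adeleVecE_apply_snd F E c hcδ hδ k ab j).symm
  obtain ⟨a, b⟩ := ab
  unfold archPairMixedInv
  simp only [key]
  exact Prod.ext (piArch_archVec a) (piArch_archVec b)

/-- right inverse. [cite: CasselsFrohlichANT1967, Ch. II §14] -/
theorem archPairMixedFun_archPairMixedInv (y : k → mixedSpace E) :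
    archPairMixedFun F E c hcδ hδ k (archPairMixedInv F E c hcδ hδ k y) = y := by
  funext j
  unfold archPairMixedFun archPairMixedInv
  rw [piArch_apply, adeleVecE_apply]
  have h1 : (quadraticAdeleEquiv F E c hcδ hδ
      (archVec F k (piArch F k fun j => (splitArch F E c hcδ hδ (y j)).1) j,
        archVec F k (piArch F k fun j => (splitArch F E c hcδ hδ (y j)).2) j)).1 =
      (quadraticAdeleEquiv F E c hcδ hδ ((splitArch F E c hcδ hδ (y j)).1, (splitArch F E c hcδ hδ (y j)).2)).1 :=
    quadraticAdeleEquiv_fst_congr F E c hcδ hδ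
      (by rw [archVec_apply_fst, piArch_apply, RingEquiv.symm_apply_apply])
      (by rw [archVec_apply_fst, piArch_apply, RingEquiv.symm_apply_apply])
  rw [h1, Prod.mk.eta, quadraticAdeleEquiv_splitArch, infiniteAdeleInl_apply, RingEquiv.apply_symm_apply]

/-- **`((F ⊗ ℝ)^k × (F ⊗ ℝ)^k) ≃+ (E ⊗ ℝ)^k`** (additive, with the explicit inverse). [cite: CasselsFrohlichANT1967, Ch. II §14] -/
def archPairMixedAddEquiv : ((k → mixedSpace F) × (k → mixedSpace F)) ≃+ (k → mixedSpace E) where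
  toFun := archPairMixedFun F E c hcδ hδ k
  invFun := archPairMixedInv F E c hcδ hδ k
  left_inv := archPairMixedInv_archPairMixedFun F E c hcδ hδ k
  right_inv := archPairMixedFun_archPairMixedInv F E c hcδ hδ k
  map_add' ab ab' := by
    change piArch E k (adeleVecE F E c hcδ hδ k (ab + ab')) =
      piArch E k (adeleVecE F E c hcδ hδ k ab) + piArch E k (adeleVecE F E c hcδ hδ k ab')
    rw [adeleVecE_add, piArch_add]

/-- `(a, b) ↦ archVec a j` is continuous. [cite: CasselsFrohlichANT1967, Ch. II §14] -/
theorem continuous_archVec_apply (K : Type) [Field K] [NumberField K] (j : k) :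
    Continuous fun a : k → mixedSpace K => archVec K k a j := by
  have h : Continuous fun a : k → mixedSpace K => piAdeleSplit K k (a, 0) :=
    (piAdeleSplit K k).continuous.comp (Continuous.prodMk continuous_id continuous_const)
  exact (continuous_apply j).comp h

/-- the forward map is continuous. [cite: CasselsFrohlichANT1967, Ch. II §14] -/
theorem continuous_archPairMixedFun : Continuous (archPairMixedFun F E c hcδ hδ k) := by
  refine continuous_pi fun j => ?_
  change Continuous fun ab : (k → mixedSpace F) × (k → mixedSpace F) =>
    InfiniteAdeleRing.ringEquiv_mixedSpace E (adeleVecE F E c hcδ hδ k ab j).1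
  refine (continuous_ringEquiv_mixedSpace (K := E)).comp (continuous_fst.comp ?_)
  change Continuous fun ab : (k → mixedSpace F) × (k → mixedSpace F) =>
    quadraticAdeleEquiv F E c hcδ hδ (archVec F k ab.1 j, archVec F k ab.2 j)
  exact (quadraticAdeleEquiv F E c hcδ hδ).continuous.comp
    (((continuous_archVec_apply k F j).comp continuous_fst).prodMk
      ((continuous_archVec_apply k F j).comp continuous_snd))

/-- `splitArch` is continuous. [cite: CasselsFrohlichANT1967, Ch. II §14] -/
theorem continuous_splitArch : Continuous (splitArch F E c hcδ hδ) :=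
  (quadraticAdeleEquiv F E c hcδ hδ).symm.continuous.comp
    ((continuous_infiniteAdeleInl E).comp (continuous_ringEquiv_mixedSpace_symm (K := E)))

/-- the inverse map is continuous. [cite: CasselsFrohlichANT1967, Ch. II §14] -/
theorem continuous_archPairMixedInv : Continuous (archPairMixedInv F E c hcδ hδ k) := by
  have h1 : Continuous fun y : k → mixedSpace E => fun j => (splitArch F E c hcδ hδ (y j)).1 :=
    continuous_pi fun j => continuous_fst.comp ((continuous_splitArch F E c hcδ hδ).comp (continuous_apply j))
  have h2 : Continuous fun y : k → mixedSpace E => fun j => (splitArch F E c hcδ hδ (y j)).2 :=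
    continuous_pi fun j => continuous_snd.comp ((continuous_splitArch F E c hcδ hδ).comp (continuous_apply j))
  exact (continuous_piArch.comp h1).prodMk (continuous_piArch.comp h2)

/-- **`archPairMixed : ((F ⊗ ℝ)^k × (F ⊗ ℝ)^k) ≃L[ℝ] (E ⊗ ℝ)^k`**, `(a, b) ↦ ((Ψ_𝔸 (a_j, b_j))_∞)_j` — quadratic
coordinates at `∞`, vector-wise; real-linear as a continuous additive bijection (`AddEquiv.toRealLinearEquiv`).
[cite: CasselsFrohlichANT1967, Ch. II §14] -/
def archPairMixed : ((k → mixedSpace F) × (k → mixedSpace F)) ≃L[ℝ] (k → mixedSpace E) :=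
  (archPairMixedAddEquiv F E c hcδ hδ k).toRealLinearEquiv (continuous_archPairMixedFun F E c hcδ hδ k)
    (continuous_archPairMixedInv F E c hcδ hδ k)

/-- `archPairMixed (a, b) j = (Ψ_𝔸 (archVec a j, archVec b j))_∞`. [cite: CasselsFrohlichANT1967, Ch. II §14] -/
theorem archPairMixed_apply (ab : (k → mixedSpace F) × (k → mixedSpace F)) :
    archPairMixed F E c hcδ hδ k ab = piArch E k (adeleVecE F E c hcδ hδ k ab) := rfl

/-! ## §3 The archimedean restriction-of-scalars action of `G ∈ M_k(𝔸_E)` and its determinant -/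

section Res

variable [Fintype k] [DecidableEq k]

/-- **`archResFun G (a, b)`**: the archimedean parts of the quadratic coordinates of `G · adeleVecE (a, b)` — for
`g ∈ U(J)(𝔸_F)` this is `archAct (ι_𝔸 g) (a, b)` (`adelicToSymplectic_reIm`). [cite: GelbartRogawski1991, §3.1 p. 454] -/
def archResFun (G : Matrix k k (AdeleRing (𝓞 E) E)) (ab : (k → mixedSpace F) × (k → mixedSpace F)) :
    (k → mixedSpace F) × (k → mixedSpace F) :=
  (piArch F k (reIm (quadraticAdeleEquiv F E c hcδ hδ).toAddEquiv k (G *ᵥ adeleVecE F E c hcδ hδ k ab)).1,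
    piArch F k (reIm (quadraticAdeleEquiv F E c hcδ hδ).toAddEquiv k (G *ᵥ adeleVecE F E c hcδ hδ k ab)).2)

omit [Fintype k] [DecidableEq k] in
/-- the archimedean part of `(reIm Ψ_𝔸)⁻¹ (P, Q)` depends only on those of `P`, `Q`. [cite: CasselsFrohlichANT1967, Ch. II §14] -/
theorem piArch_reIm_symm_archVec_piArch (P Q : k → AdeleRing (𝓞 F) F) :
    piArch E k ((reIm (quadraticAdeleEquiv F E c hcδ hδ).toAddEquiv k).symm
        (archVec F k (piArch F k P), archVec F k (piArch F k Q))) =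
      piArch E k ((reIm (quadraticAdeleEquiv F E c hcδ hδ).toAddEquiv k).symm (P, Q)) := by
  funext j
  rw [piArch_apply, piArch_apply, reIm_symm_apply, reIm_symm_apply]
  refine congrArg _ (quadraticAdeleEquiv_fst_congr F E c hcδ hδ ?_ ?_)
  · rw [archVec_apply_fst, piArch_apply, RingEquiv.symm_apply_apply]
  · rw [archVec_apply_fst, piArch_apply, RingEquiv.symm_apply_apply]

omit [DecidableEq k] in
/-- **`archPairMixed` intertwines `archResFun G` with `y ↦ G_∞ y`.** [cite: GelbartRogawski1991, §3.1 p. 454] -/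
theorem archPairMixed_archResFun (G : Matrix k k (AdeleRing (𝓞 E) E)) (ab : (k → mixedSpace F) × (k → mixedSpace F)) :
    archPairMixed F E c hcδ hδ k (archResFun F E c hcδ hδ k G ab) =
      archMat E k G *ᵥ archPairMixed F E c hcδ hδ k ab := by
  rw [archPairMixed_apply, archPairMixed_apply, ← piArch_mulVec]
  unfold adeleVecE archResFun
  dsimp only
  rw [piArch_reIm_symm_archVec_piArch, Prod.mk.eta, AddEquiv.symm_apply_apply]
  rfl

/-- **`archResLin G`**: the archimedean restriction-of-scalars action of `G ∈ M_k(𝔸_E)` on the pairs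
`(F ⊗ ℝ)^k × (F ⊗ ℝ)^k` as a REAL-LINEAR map (`y ↦ G_∞ y` on `(E ⊗ ℝ)^k`, conjugated by `archPairMixed`).
[cite: GelbartRogawski1991, §3.1 p. 454] -/
def archResLin (G : Matrix k k (AdeleRing (𝓞 E) E)) :
    ((k → mixedSpace F) × (k → mixedSpace F)) →ₗ[ℝ] ((k → mixedSpace F) × (k → mixedSpace F)) :=
  ((archPairMixed F E c hcδ hδ k).toLinearEquiv.symm :
      (k → mixedSpace E) →ₗ[ℝ] ((k → mixedSpace F) × (k → mixedSpace F))) ∘ₗ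
    ((Matrix.toLin' (archMat E k G)).restrictScalars ℝ) ∘ₗ
      ((archPairMixed F E c hcδ hδ k).toLinearEquiv :
        ((k → mixedSpace F) × (k → mixedSpace F)) →ₗ[ℝ] (k → mixedSpace E))

/-- **`archResLin G = archResFun G`** pointwise. [cite: GelbartRogawski1991, §3.1 p. 454] -/
theorem archResLin_apply (G : Matrix k k (AdeleRing (𝓞 E) E)) (ab : (k → mixedSpace F) × (k → mixedSpace F)) :
    archResLin F E c hcδ hδ k G ab = archResFun F E c hcδ hδ k G ab := by
  apply (archPairMixed F E c hcδ hδ k).injective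
  rw [archPairMixed_archResFun]
  exact (archPairMixed F E c hcδ hδ k).apply_symm_apply _

/-- **`det_ℝ (archResLin G) = N_{(E ⊗ ℝ)/ℝ} (det G_∞)`** (Mathlib `LinearMap.det_conj`, `LinearMap.det_restrictScalars`).
[cite: Kudla1994, §3] -/
theorem det_archResLin (G : Matrix k k (AdeleRing (𝓞 E) E)) :
    LinearMap.det (archResLin F E c hcδ hδ k G) = Algebra.norm ℝ (archMat E k G).det := by
  have h := LinearMap.det_conj ((Matrix.toLin' (archMat E k G)).restrictScalars ℝ)
    (archPairMixed F E c hcδ hδ k).toLinearEquiv.symm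
  rw [LinearMap.det_restrictScalars, LinearMap.det_toLin'] at h
  exact h

/-! ## §4 `E` totally complex: `N_{(E ⊗ ℝ)/ℝ}(x) = ∏_w |x_w|²` and the determinant place by place -/

/-- **`N_{(E ⊗ ℝ)/ℝ}(x) = ∏_w |x_w|²`** for `E` totally complex (`E ⊗ ℝ = ∏_w ℂ` over the complex places `w`;
Mathlib `Algebra.norm_complex_apply` per factor). [cite: CasselsFrohlichANT1967, Ch. II §14] -/
theorem norm_mixedSpace_of_isTotallyComplex [IsTotallyComplex E] (x : mixedSpace E) :
    Algebra.norm ℝ x = ∏ w : {w : InfinitePlace E // w.IsComplex}, Complex.normSq (x.2 w) := by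
  haveI : IsEmpty {w : InfinitePlace E // w.IsReal} :=
    ⟨fun w => (not_isReal_iff_isComplex.2 (IsTotallyComplex.isComplex w.1)) w.2⟩
  rw [Algebra.norm_apply]
  have h1 : (Algebra.lmul ℝ (mixedSpace E) x : mixedSpace E →ₗ[ℝ] mixedSpace E) =
      (LinearMap.mul ℝ ({w : InfinitePlace E // w.IsReal} → ℝ) x.1).prodMap
        (LinearMap.pi fun w : {w : InfinitePlace E // w.IsComplex} =>
          (LinearMap.mul ℝ ℂ (x.2 w)) ∘ₗ LinearMap.proj w) := by
    refine LinearMap.ext fun y => Prod.ext rfl (funext fun w => rfl)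
  rw [h1, LinearMap.det_prodMap, LinearMap.det_pi]
  have h2 : LinearMap.det (LinearMap.mul ℝ ({w : InfinitePlace E // w.IsReal} → ℝ) x.1) = 1 :=
    LinearMap.det_eq_one_of_subsingleton _
  rw [h2, one_mul]
  refine Finset.prod_congr rfl fun w _ => ?_
  rw [← Algebra.norm_complex_apply, Algebra.norm_apply]
  rfl

omit [Fintype k] [DecidableEq k] in
/-- `(G_∞)_w = σ_w(G_w)`: the `w`-coordinate of the archimedean part of `G` is `adeleMatAt w G`.
[cite: CasselsFrohlichANT1967, Ch. II §14] -/
theorem archMat_map_evalC (G : Matrix k k (AdeleRing (𝓞 E) E)) (w : {w : InfinitePlace E // w.IsComplex}) :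
    (archMat E k G).map (UnitaryGroup.evalC E w) = adeleMatAt E k w G := by
  ext i j
  rfl

/-- **`det_ℝ (archResLin G) = ∏_w |det σ_w(G_w)|²`** for `E` totally complex. [cite: Kudla1994, §3] -/
theorem det_archResLin_of_isTotallyComplex [IsTotallyComplex E] (G : Matrix k k (AdeleRing (𝓞 E) E)) :
    LinearMap.det (archResLin F E c hcδ hδ k G) =
      ∏ w : {w : InfinitePlace E // w.IsComplex}, Complex.normSq (adeleMatAt E k w G).det := by
  rw [det_archResLin, norm_mixedSpace_of_isTotallyComplex]
  refine Finset.prod_congr rfl fun w _ => ?_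
  rw [← archMat_map_evalC E k G w, ← RingHom.mapMatrix_apply, ← RingHom.map_det]
  rfl

/-- hence `0 < det_ℝ (archResLin G)` when every `det G_w ≠ 0` (`E` totally complex). [cite: Kudla1994, §3] -/
theorem det_archResLin_pos [IsTotallyComplex E] (G : Matrix k k (AdeleRing (𝓞 E) E))
    (hG : ∀ w : {w : InfinitePlace E // w.IsComplex}, (adeleMatAt E k w G).det ≠ 0) :
    0 < LinearMap.det (archResLin F E c hcδ hδ k G) := by
  rw [det_archResLin_of_isTotallyComplex]
  exact Finset.prod_pos fun w _ => Complex.normSq_pos.2 (hG w)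

end Res

/-! ## §5 General `E` (real places allowed): `N_{(E ⊗ ℝ)/ℝ}(x) = ∏_{w real} x_w · ∏_{w complex} |x_w|²`, and
`det_ℝ (archResLin G)` place by place — its sign is `∏_{w real} sign (det G_∞)_w`, NOT definite -/

section ResGeneral

variable [Fintype k] [DecidableEq k]

/-- **`N_{(E ⊗ ℝ)/ℝ}(x) = ∏_{w real} x_w · ∏_{w complex} |x_w|²`** for ANY number field `E`
(`E ⊗ ℝ = ℝ^{r₁} × ℂ^{r₂}`; Mathlib `LinearMap.det_prodMap`, `LinearMap.det_pi`, `Algebra.norm_complex_apply`).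
[cite: CasselsFrohlichANT1967, Ch. II §14] -/
theorem norm_mixedSpace (x : mixedSpace E) :
    Algebra.norm ℝ x = (∏ w : {w : InfinitePlace E // w.IsReal}, x.1 w) *
      ∏ w : {w : InfinitePlace E // w.IsComplex}, Complex.normSq (x.2 w) := by
  rw [Algebra.norm_apply]
  have h1 : (Algebra.lmul ℝ (mixedSpace E) x : mixedSpace E →ₗ[ℝ] mixedSpace E) =
      (LinearMap.pi fun w : {w : InfinitePlace E // w.IsReal} => (LinearMap.mul ℝ ℝ (x.1 w)) ∘ₗ LinearMap.proj w).prodMap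
        (LinearMap.pi fun w : {w : InfinitePlace E // w.IsComplex} =>
          (LinearMap.mul ℝ ℂ (x.2 w)) ∘ₗ LinearMap.proj w) :=
    LinearMap.ext fun y => Prod.ext (funext fun w => rfl) (funext fun w => rfl)
  rw [h1, LinearMap.det_prodMap, LinearMap.det_pi, LinearMap.det_pi]
  congr 1
  · refine Finset.prod_congr rfl fun w _ => ?_
    have : LinearMap.mul ℝ ℝ (x.1 w) = (x.1 w) • (LinearMap.id : ℝ →ₗ[ℝ] ℝ) :=
      LinearMap.ext fun t => by simp [smul_eq_mul]
    rw [this, LinearMap.det_smul, LinearMap.det_id, mul_one, Module.finrank_self, pow_one]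
  · refine Finset.prod_congr rfl fun w _ => ?_
    rw [← Algebra.norm_complex_apply, Algebra.norm_apply]
    rfl

/-- **`det_ℝ (archResLin G) = ∏_{w real} (det G_∞)_w · ∏_{w complex} |det σ_w(G_w)|²`** for ANY `E`: when `E` has real
places the sign of `det_ℝ (archResLin G)` is `∏_{w real} sign (det G_∞)_w` (e.g. `−1` for the Levi sign representative
flipping one real coordinate), so the totally-complex positivity `det_archResLin_pos` does not persist. [cite: Kudla1994, §3] -/
theorem det_archResLin_eq_prod (G : Matrix k k (AdeleRing (𝓞 E) E)) :
    LinearMap.det (archResLin F E c hcδ hδ k G) =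
      (∏ w : {w : InfinitePlace E // w.IsReal}, (archMat E k G).det.1 w) *
        ∏ w : {w : InfinitePlace E // w.IsComplex}, Complex.normSq (adeleMatAt E k w G).det := by
  rw [det_archResLin, norm_mixedSpace]
  congr 1
  refine Finset.prod_congr rfl fun w _ => ?_
  rw [← archMat_map_evalC E k G w, ← RingHom.mapMatrix_apply, ← RingHom.map_det]
  rfl

/-- `det_ℝ (archResLin G) ≠ 0` as soon as every local determinant is non-zero (any `E`). [cite: Kudla1994, §3] -/
theorem det_archResLin_ne_zero (G : Matrix k k (AdeleRing (𝓞 E) E))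
    (hR : ∀ w : {w : InfinitePlace E // w.IsReal}, (archMat E k G).det.1 w ≠ 0)
    (hC : ∀ w : {w : InfinitePlace E // w.IsComplex}, (adeleMatAt E k w G).det ≠ 0) :
    LinearMap.det (archResLin F E c hcδ hδ k G) ≠ 0 := by
  rw [det_archResLin_eq_prod]
  exact mul_ne_zero (Finset.prod_ne_zero_iff.2 fun w _ => hR w)
    (Finset.prod_ne_zero_iff.2 fun w _ => (Complex.normSq_pos.2 (hC w)).ne')

/-- **`|det_ℝ (archResLin G)| = ∏_{w real} |(det G_∞)_w| · ∏_{w complex} |det σ_w(G_w)|²`** (any `E`) — the modulus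
part, to be compared with `modDelta²`; the sign is carried separately. [cite: Kudla1994, §3] -/
theorem abs_det_archResLin_eq_prod (G : Matrix k k (AdeleRing (𝓞 E) E)) :
    |LinearMap.det (archResLin F E c hcδ hδ k G)| =
      (∏ w : {w : InfinitePlace E // w.IsReal}, |(archMat E k G).det.1 w|) *
        ∏ w : {w : InfinitePlace E // w.IsComplex}, Complex.normSq (adeleMatAt E k w G).det := by
  rw [det_archResLin_eq_prod, abs_mul, Finset.abs_prod, abs_of_nonneg]
  exact Finset.prod_nonneg fun w _ => Complex.normSq_nonneg _

end ResGeneral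

end Literature.NumberTheory.Weil1964

end
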